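import Literature.AnabelianGeometry.SemiGraphs.ArithDecompositionData
import Literature.AnabelianGeometry.SemiGraphs.ArithCompactInVerticialConj1
import Literature.AnabelianGeometry.SemiGraphs.ArithCompactInVerticialConj2
import Literature.AnabelianGeometry.SemiGraphs.ArithEstrangementNoBranchPair
import Literature.AnabelianGeometry.SemiGraphs.ArithMaximalCompactReductions
import Literature.AnabelianGeometry.SemiGraphs.ArithEdgeLikeOfLevelData
import Literature.AnabelianGeometry.SemiGraphs.ArithLevelData
import HarnessLib

/-!
# [SemiAnbd] Theorem 5.4 (i), (ii) ASSEMBLED over arithmetic level data (sub-DAG T54, packaged form)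

Mochizuki, *Semi-graphs of anabelioids*, Publ. RIMS **42** (2006), §5, Theorem 5.4 (i), (ii), manuscript
p. 66 (kurims `paper:url-f33ace170ff4`). [cite: MochizukiSemiAnbd2006, Thm 5.4, p. 66]

Proof-only ASSEMBLY (abc-iut-w4-d053, coordinator ruling R24 of abc-iut-w4-d085; sub-DAG
`plan/L3/SUBDAG-SemiAnbd-Thm54.md`): the typed conclusions `ArithMaximalCompactStatementI D aug` and
`ArithMaximalCompactStatementII D aug` of abc-iut-L3-t3's `ArithMaximalCompact.lean`, for decomposition data
`D` over a semi-graph all of whose branches abut to a vertex, FROM an arithmetic level datum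
`L : ArithLevelData 𝔾 D aug baseAct` (the hypothesis package of `ArithLevelData.lean`: the arithmetic
tree/level system with its two-sided stabiliser dictionary — producer debt T54-B, plan/GAP-LEDGER.md
G-w4d053-1), total arithmetic estrangement (Def 5.3 (ii)), `⊥` not arithmetically ample (`Π_A` not
discrete — abc-iut-w4-d059's observation O-T54-3; print's `Π_A` is infinite profinite), and for (ii) in
addition Rmk 5.3.1's first sentence (`hR`, row T54-1) and the rigidity "no verticial subgroup is
edge-like" (`hVE`, row T54-2 with the geometric fact "verticial ≠ edge-like").  The mathematics is in the
rows: clause 1 of (i) = abc-iut-w4-d029's `arith_conj1_of_hstar_ample` (ArithCompactInVerticialConj1),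
(∗_j) = abc-iut-w4-d029's `hstar_of_isArithAmple` (ArithEstrangementNoBranchPair), clause 2 and the
assembly of (i) = abc-iut-w4-d059's `arithMaximalCompactStatementI_of_levelData`
(ArithCompactInVerticialConj2), hEV = abc-iut-w4-d059's `exists_verticial_inf_eq_of_isEdgeLike_of_levelData`
(ArithEdgeLikeOfLevelData), (ii) from (i) = abc-iut-w4-d085's `arithMaximalCompactStatementII_of'`
(ArithMaximalCompactReductions) — "entirely parallel to Theorem 3.7" (p. 66), via abc-iut-L3-t11's generic
tree-system lemmas.  This file only feeds the fields of `L` to them (the field texts are their binders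
verbatim; `noSwap` is derived from the base-level no-switching hypothesis).  CONDITIONAL on the named
inputs; typed ≠ proved beyond them; nothing here bears on [IUTchIII] Cor 3.12.
-/

namespace Literature.AnabelianGeometry.SemiGraphs

open CategoryTheory Topology

universe v₁ u₁ u₁' u₁''

namespace ArithLevelData

variable {Gtp : Type u₁} [Group Gtp] [TopologicalSpace Gtp] [IsTopologicalGroup Gtp]
  {PA : Type u₁'} [Group PA] [TopologicalSpace PA] [IsTopologicalGroup PA]
  {𝔾 : SemiGraph.{u₁}} {D : DecompositionData Gtp 𝔾.Vertex 𝔾.Branch} {aug : Gtp →* PA}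
  {baseAct : PA →* Aut 𝔾}

/-- **[SemiAnbd] Thm 5.4 (i) ASSEMBLED over arithmetic level data** (the "10-line repackaging",
abc-iut-L3-lead gen 3 α3-4 / coordinator R9): for decomposition data `D` over a semi-graph all of whose
branches abut to a vertex, an arithmetic level datum `L` (the hypothesis package of `ArithLevelData.lean`),
total arithmetic estrangement and `⊥` not arithmetically ample (`Π_A` not discrete, abc-iut-w4-d059's
O-T54-3), `ArithMaximalCompactStatementI D aug` holds — by abc-iut-w4-d059's
`arithMaximalCompactStatementI_of_levelData` (p413068) fed with abc-iut-w4-d029's clause 1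
`arith_conj1_of_hstar_ample` (p413617) and (∗_j) `hstar_of_isArithAmple` (p413191), all binders supplied by
the fields of `L` (`noSwap` derived from the base-level no-switching hypothesis).  CONDITIONAL on the
package `L`; typed ≠ proved beyond it. [cite: MochizukiSemiAnbd2006, Thm 5.4 (i), p. 66] -/
theorem arithMaximalCompactStatementI_of (L : ArithLevelData.{v₁} 𝔾 D aug baseAct)
    (habuts : ∀ b : 𝔾.Branch, ∃ v : 𝔾.Vertex, D.abut b = some v)
    (hest : IsTotallyArithEstranged D aug) (hbot : ¬ IsArithAmple aug ⊥) :
    ArithMaximalCompactStatementI D aug := by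
  -- every edge-like subgroup lies in a verticial one (p.65 `Π_{𝔊,b} ⊆ Π_{𝔊,v}`)
  have hEdgeVert : ∀ K : Subgroup Gtp, IsEdgeLike D K → ∃ W : Subgroup Gtp, IsVerticial D W ∧ K ≤ W := by
    rintro _ ⟨b, g, rfl⟩
    obtain ⟨v, hv⟩ := habuts b
    exact ⟨conjSubgroup g (D.vertGp v), ⟨v, g, rfl⟩, Subgroup.map_mono (D.brGp_le_vertGp b v hv)⟩
  -- (∗_j) for every arithmetically ample compact subgroup (row T54-3a)
  have hstar : ∀ C : Subgroup Gtp, IsCompact (C : Set Gtp) → IsArithAmple aug C →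
      ∀ j : L.J, ∃ (i : L.J) (h : j ≤ i), ∀ e e' : (L.tree i).Edge,
        (∀ γ : C, (L.act i γ).hom.edgeMap e = e) → (∀ γ : C, (L.act i γ).hom.edgeMap e' = e') →
        (L.trans h).edgeMap e = (L.trans h).edgeMap e' := fun C _ hCA j =>
    hstar_of_isArithAmple L.tree L.isTree L.act L.trans L.quot L.quot_isImmersion L.act_quot
      L.levelTrans_id L.levelTrans_comp L.levelTrans_act L.trans_quot L.stabBranchPair hest hbot C hCA j
  refine arithMaximalCompactStatementI_of_levelData D aug L.tree L.act L.trans L.isTree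
    L.trans_act_vertexMap L.noSwap L.fix L.edge ?_ hstar
  -- clause 1 (row T54-3b)
  exact arith_conj1_of_hstar_ample D L.tree L.act L.trans aug L.isTree L.vertex L.isOpen_ker
    L.trans_comp L.trans_act L.noSwap (fun x hx => (L.stab x hx).imp fun W h => ⟨h.1, fun g hg => (h.2 g).mpr hg⟩)
    (fun j₁ ε hε => (L.edge j₁ ε hε).imp fun K h => ⟨h.1, fun g hg => (h.2 g).mpr hg⟩)
    hEdgeVert hstar

/-- **[SemiAnbd] Thm 5.4 (ii) ASSEMBLED over arithmetic level data** (coordinator abc-iut-w4-d085's assembly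
`arithMaximalCompactStatementII_of'`, p412558, over the package): given moreover Rmk 5.3.1's first sentence
(`hR`, row T54-1) and the rigidity "no verticial subgroup is edge-like" (`hVE`, row T54-2 + geometric
`hne`), "the arithmetically maximal compact subgroups are precisely the verticial subgroups; the
arithmetically ample intersections of two distinct ones are precisely the edge-like subgroups" —
with (i) from `arithMaximalCompactStatementI_of` and hEV from abc-iut-w4-d059's
`exists_verticial_inf_eq_of_isEdgeLike_of_levelData` (p413677) fed by the fields `stab`, `edgeFix`.
CONDITIONAL on the package `L` and the named inputs. [cite: MochizukiSemiAnbd2006, Thm 5.4 (ii), p. 66] -/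
theorem arithMaximalCompactStatementII_of [T2Space Gtp] (L : ArithLevelData.{v₁} 𝔾 D aug baseAct)
    (habuts : ∀ b : 𝔾.Branch, ∃ v : 𝔾.Vertex, D.abut b = some v)
    (hest : IsTotallyArithEstranged D aug) (hbot : ¬ IsArithAmple aug ⊥)
    (hR : VerticialEdgeLikeCompactAmpleStatement D aug)
    (hVE : ∀ K : Subgroup Gtp, IsVerticial D K → ¬ IsEdgeLike D K) :
    ArithMaximalCompactStatementII D aug :=
  arithMaximalCompactStatementII_of' (L.arithMaximalCompactStatementI_of habuts hest hbot) hR hVE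
    (exists_verticial_inf_eq_of_isEdgeLike_of_levelData D L.tree L.act L.trans L.isTree
      L.trans_act_vertexMap L.noSwap L.stab L.edgeFix hVE)

end ArithLevelData

end Literature.AnabelianGeometry.SemiGraphs
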